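import Mathlib
import HarnessLib

/-!
# Sabidussi's theorem: the chromatic number of a Cartesian product

Source: Imrich–Klavžar–Rall, *Topics in Graph Theory: Graphs and Their Cartesian Product*
(A K Peters 2008), §8.1 "Vertex colorings", Theorem 8.1 [103] (Sabidussi 1957, *Graphs with given
group and given graph-theoretical properties*, Canad. J. Math. 9, 515–525):
for any two graphs `χ(G □ H) = max{χ(G), χ(H)}` (also Hammack–Imrich–Klavžar, *Handbook of Product
Graphs*, 2nd ed. (CRC 2011), Theorem 26.1: "Sabidussi (1957) gave a complete and satisfactory answer …
The result has been rediscovered several times"). The lower bound holds because `G □ H` contains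
copies of `G` and of `H` (the fibres); the upper bound is the book's *modular colouring*
`c(g, h) = c_G(g) + c_H(h) (mod k)` built from `k`-colourings of the factors: an edge of `G □ H`
lies in a `G`-fibre or in an `H`-fibre, and cancelling the common summand reduces properness of `c`
to that of `c_G`, resp. `c_H`. Also inequality (8.1) of the same section,
`n = Σᵢ |Vᵢ| ≤ α(G) χ(G)` (the colour classes `Vᵢ` of a colouring are independent sets).

Everything is stated over Mathlib's `SimpleGraph.boxProd` (`□`), `SimpleGraph.Coloring`,
`SimpleGraph.Colorable`, `SimpleGraph.chromaticNumber` (valued in `ℕ∞`) and `SimpleGraph.indepNum`.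
No definitions are introduced: the modular colouring is recorded as the statement that the sums
`c_G(g) + c_H(h)` separate adjacent vertices (over any colour type with a cancellative addition, e.g.
`Fin k`) and as the existence of a `Coloring` with these values. Mathlib's `chromaticNumber` needs no
finiteness, so Theorem 8.1
is stated for arbitrary (possibly infinite) graphs with nonempty vertex types — for an empty factor the
product is empty and has chromatic number `0`, so nonemptiness cannot be dropped.

* `add_ne_add_of_boxProd_adj`, `exists_coloring_boxProd_eq_add` — the modular colouring
  `(g, h) ↦ c_G(g) + c_H(h)` of `G □ H` (proof of Theorem 8.1).
* `colorable_boxProd`, `colorable_of_boxProd_left`, `colorable_of_boxProd_right`,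
  `colorable_boxProd_iff` — `G □ H` is `n`-colourable iff both factors are.
* `chromaticNumber_le_boxProd_left`, `chromaticNumber_le_boxProd_right`, `chromaticNumber_boxProd_le`,
  `chromaticNumber_boxProd` — Theorem 8.1, `χ(G □ H) = max{χ(G), χ(H)}`.
* `chromaticNumber_boxProd_top`, `chromaticNumber_boxProd_self`, `chromaticNumber_top_two_boxProd_top_three`
  — `χ(G □ K_m) = max{χ(G), m}`, `χ(G □ G) = χ(G)`, and the instance `χ(K₂ □ K₃) = 3`.
* `card_le_indepNum_mul_of_colorable`, `card_le_indepNum_mul_chromaticNumber` — inequality (8.1).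
-/

namespace Literature.Combinatorics.SimpleGraph.SabidussiColoring

open Finset _root_.SimpleGraph

variable {V W : Type*} {G : SimpleGraph V} {H : SimpleGraph W}

/-! ## The modular colouring (proof of IKR Theorem 8.1) -/

/-- [cite: ImrichKlavzarRall2008, Theorem 8.1 (proof: "c_G(g₁) + c_H(h) ≠ c_G(g₂) + c_H(h) (mod k)"
on an edge of a fibre G^h, "c(g,h₁) = c_G(g) + c_H(h₁) ≠ c_G(g) + c_H(h₂) = c(g,h₂)" on an edge of a
fibre ^gH)]; [cite: Sabidussi1957]
The heart of the **modular colouring**: for colourings `c_G`, `c_H` of the factors with values in one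
colour type carrying a cancellative addition (the book uses `ℤ/kℤ`; `Fin k` works verbatim), the sums
`c_G(g) + c_H(h)` differ along every edge of `G □ H`. An edge `(g₁,h)(g₂,h)` of a `G`-fibre: by right
cancellation and `c_G(g₁) ≠ c_G(g₂)`; an edge `(g,h₁)(g,h₂)` of an `H`-fibre: by left cancellation
and `c_H(h₁) ≠ c_H(h₂)`. -/
theorem add_ne_add_of_boxProd_adj {α : Type*} [Add α] [IsCancelAdd α] (cG : G.Coloring α)
    (cH : H.Coloring α) {p q : V × W} (hadj : (G □ H).Adj p q) :
    cG p.1 + cH p.2 ≠ cG q.1 + cH q.2 := by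
  rcases boxProd_adj.1 hadj with ⟨h1, h2⟩ | ⟨h2, h1⟩
  · rw [h2]
    exact fun heq => cG.valid h1 (add_right_cancel heq)
  · rw [h1]
    exact fun heq => cH.valid h2 (add_left_cancel heq)

/-- [cite: ImrichKlavzarRall2008, Theorem 8.1 (proof: "we construct a coloring c of G □ H as
follows … c(g,h) = c_G(g) + c_H(h) (mod k)")]; [cite: Sabidussi1957]
The modular colouring exists as a colouring of `G □ H` in Mathlib's sense: there is a proper
colouring `c` of `G □ H` with `c(g, h) = c_G(g) + c_H(h)` for all vertices. -/
theorem exists_coloring_boxProd_eq_add {α : Type*} [Add α] [IsCancelAdd α] (cG : G.Coloring α)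
    (cH : H.Coloring α) : ∃ c : (G □ H).Coloring α, ∀ p : V × W, c p = cG p.1 + cH p.2 :=
  ⟨Coloring.mk (fun p => cG p.1 + cH p.2) (add_ne_add_of_boxProd_adj cG cH), fun _ => rfl⟩

/-- [cite: ImrichKlavzarRall2008, Theorem 8.1 (proof: colourings of G and H with k ≥ χ(G), χ(H)
colours give a k-colouring of G □ H)]; [cite: Sabidussi1957]
If both factors are `n`-colourable then so is `G □ H` (modular colouring with values in `Fin n`). -/
theorem colorable_boxProd {n : ℕ} (hG : G.Colorable n) (hH : H.Colorable n) :
    (G □ H).Colorable n := by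
  obtain ⟨cG⟩ := hG
  obtain ⟨cH⟩ := hH
  obtain ⟨c, -⟩ := exists_coloring_boxProd_eq_add cG cH
  exact ⟨c⟩

/-- [cite: ImrichKlavzarRall2008, Theorem 8.1 (proof: "G □ H has subgraphs isomorphic to G")];
[cite: Sabidussi1957]
A colouring of `G □ H` restricts to a colouring of the fibre `G □ {h} ≅ G` (needs a vertex `h` of `H`). -/
theorem colorable_of_boxProd_left [Nonempty W] {n : ℕ} (h : (G □ H).Colorable n) :
    G.Colorable n :=
  h.of_hom (boxProdLeft (G := G) (H := H) (Classical.arbitrary W)).toHom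

/-- [cite: ImrichKlavzarRall2008, Theorem 8.1 (proof: "G □ H has subgraphs isomorphic to H")];
[cite: Sabidussi1957]
A colouring of `G □ H` restricts to a colouring of the fibre `{g} □ H ≅ H` (needs a vertex `g` of `G`). -/
theorem colorable_of_boxProd_right [Nonempty V] {n : ℕ} (h : (G □ H).Colorable n) :
    H.Colorable n :=
  h.of_hom (boxProdRight (G := G) (H := H) (Classical.arbitrary V)).toHom

/-- [cite: ImrichKlavzarRall2008, Theorem 8.1 (n-colourability form)]; [cite: Sabidussi1957]
For nonempty factors, `G □ H` is `n`-colourable iff `G` and `H` both are. -/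
theorem colorable_boxProd_iff [Nonempty V] [Nonempty W] {n : ℕ} :
    (G □ H).Colorable n ↔ G.Colorable n ∧ H.Colorable n :=
  ⟨fun h => ⟨colorable_of_boxProd_left h, colorable_of_boxProd_right h⟩,
    fun h => colorable_boxProd h.1 h.2⟩

/-! ## Theorem 8.1 -/

/-- [cite: ImrichKlavzarRall2008, Theorem 8.1 (proof, first sentence: χ(G □ H) ≥ χ(G))];
[cite: Sabidussi1957]
`χ(G) ≤ χ(G □ H)` as soon as `H` has a vertex. -/
theorem chromaticNumber_le_boxProd_left [Nonempty W] :
    G.chromaticNumber ≤ (G □ H).chromaticNumber :=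
  chromaticNumber_mono_of_hom (boxProdLeft (G := G) (H := H) (Classical.arbitrary W)).toHom

/-- [cite: ImrichKlavzarRall2008, Theorem 8.1 (proof, first sentence: χ(G □ H) ≥ χ(H))];
[cite: Sabidussi1957]
`χ(H) ≤ χ(G □ H)` as soon as `G` has a vertex. -/
theorem chromaticNumber_le_boxProd_right [Nonempty V] :
    H.chromaticNumber ≤ (G □ H).chromaticNumber :=
  chromaticNumber_mono_of_hom (boxProdRight (G := G) (H := H) (Classical.arbitrary V)).toHom

/-- [cite: ImrichKlavzarRall2008, Theorem 8.1 (upper bound χ(G □ H) ≤ k = max{χ(G), χ(H)} via the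
modular colouring)]; [cite: Sabidussi1957]
`χ(G □ H) ≤ max{χ(G), χ(H)}` (no hypotheses; both sides may be `⊤` for infinite graphs). -/
theorem chromaticNumber_boxProd_le :
    (G □ H).chromaticNumber ≤ max G.chromaticNumber H.chromaticNumber := by
  by_cases hG : G.chromaticNumber = ⊤
  · exact le_max_of_le_left (le_top.trans_eq hG.symm)
  by_cases hH : H.chromaticNumber = ⊤
  · exact le_max_of_le_right (le_top.trans_eq hH.symm)
  obtain ⟨m, hm⟩ := chromaticNumber_ne_top_iff_exists.1 hG
  obtain ⟨m', hm'⟩ := chromaticNumber_ne_top_iff_exists.1 hH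
  have hGc := colorable_chromaticNumber hm
  have hHc := colorable_chromaticNumber hm'
  rcases le_total G.chromaticNumber.toNat H.chromaticNumber.toNat with hle | hle
  · exact le_max_of_le_right
      ((colorable_boxProd (hGc.mono hle) hHc).chromaticNumber_le.trans_eq (ENat.coe_toNat hH))
  · exact le_max_of_le_left
      ((colorable_boxProd hGc (hHc.mono hle)).chromaticNumber_le.trans_eq (ENat.coe_toNat hG))

/-- [cite: ImrichKlavzarRall2008, Theorem 8.1 ("For any two graphs G and H,
χ(G □ H) = max{χ(G), χ(H)}")]; [cite: Sabidussi1957];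
[cite: HammackImrichKlavzar2011, Theorem 26.1 (f(a,x) = g(a) + h(x) mod χ(G))]
**Sabidussi's theorem.** For graphs with nonempty vertex sets (finite or not),
`χ(G □ H) = max{χ(G), χ(H)}` in `ℕ∞`. (For an empty factor the product is empty and the left side
is `0`, so the hypotheses cannot be dropped.) -/
theorem chromaticNumber_boxProd [Nonempty V] [Nonempty W] :
    (G □ H).chromaticNumber = max G.chromaticNumber H.chromaticNumber :=
  le_antisymm chromaticNumber_boxProd_le
    (max_le chromaticNumber_le_boxProd_left chromaticNumber_le_boxProd_right)

/-! ## Consequences and an instance -/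

/-- [cite: ImrichKlavzarRall2008, Theorem 8.1 (special case H = K_m, χ(K_m) = m)];
[cite: Sabidussi1957]
`χ(G □ K_m) = max{χ(G), m}`. -/
theorem chromaticNumber_boxProd_top [Nonempty V] [Fintype W] [Nonempty W] :
    (G □ (⊤ : SimpleGraph W)).chromaticNumber = max G.chromaticNumber (Fintype.card W : ℕ∞) := by
  rw [chromaticNumber_boxProd, chromaticNumber_top]

/-- [cite: ImrichKlavzarRall2008, Theorem 8.1 (special case H = G)]; [cite: Sabidussi1957]
`χ(G □ G) = χ(G)`. -/
theorem chromaticNumber_boxProd_self [Nonempty V] : (G □ G).chromaticNumber = G.chromaticNumber := by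
  rw [chromaticNumber_boxProd, max_self]

/-- [cite: ImrichKlavzarRall2008, Theorem 8.1 (instance: χ(K₂ □ K₃) = max{2, 3} = 3)];
[cite: Sabidussi1957]
Instance: the prism `K₂ □ K₃` has chromatic number `3`. -/
theorem chromaticNumber_top_two_boxProd_top_three :
    ((⊤ : SimpleGraph (Fin 2)) □ (⊤ : SimpleGraph (Fin 3))).chromaticNumber = 3 := by
  rw [chromaticNumber_boxProd, chromaticNumber_top, chromaticNumber_top, Fintype.card_fin,
    Fintype.card_fin]
  exact max_eq_right (by exact_mod_cast (show (2 : ℕ) ≤ 3 by norm_num))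

/-! ## Inequality (8.1): `n ≤ α(G) χ(G)` -/

/-- [cite: ImrichKlavzarRall2008, Section 8.1 eq. (8.1) (n = Σ_{i ≤ χ(G)} |V_i| ≤ α(G) χ(G), the
colour classes V_i being independent)]
A finite graph with an `n`-colouring has at most `α(G) · n` vertices: the colour classes partition
the vertex set into `n` independent sets, each of size at most `α(G)`. -/
theorem card_le_indepNum_mul_of_colorable [Fintype V] {n : ℕ} (hc : G.Colorable n) :
    Fintype.card V ≤ G.indepNum * n := by
  classical
  obtain ⟨C⟩ := hc
  have hclass : ∀ i : Fin n, G.IsIndepSet ↑(univ.filter fun v => C v = i) := by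
    intro i v hv w hw _ hadj
    simp only [coe_filter, mem_univ, true_and] at hv hw
    exact C.valid hadj (hv.trans hw.symm)
  calc Fintype.card V = ∑ i : Fin n, (univ.filter fun v => C v = i).card := by
        rw [← card_univ, card_eq_sum_card_fiberwise (f := C) (t := univ) fun _ _ => mem_univ _]
    _ ≤ ∑ _i : Fin n, G.indepNum := sum_le_sum fun i _ => (hclass i).card_le_indepNum
    _ = G.indepNum * n := by rw [sum_const, card_univ, Fintype.card_fin, smul_eq_mul, mul_comm]

/-- [cite: ImrichKlavzarRall2008, Section 8.1 eq. (8.1) ("n = |G| ≤ α(G)χ(G)", equivalently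
χ(G) ≥ n/α(G))]
`|V(G)| ≤ α(G) · χ(G)` for a finite graph, in `ℕ∞`. -/
theorem card_le_indepNum_mul_chromaticNumber [Fintype V] :
    (Fintype.card V : ℕ∞) ≤ G.indepNum * G.chromaticNumber := by
  have hc : G.Colorable G.chromaticNumber.toNat := colorable_chromaticNumber G.colorable_of_fintype
  have hne : G.chromaticNumber ≠ ⊤ :=
    chromaticNumber_ne_top_iff_exists.2 ⟨_, G.colorable_of_fintype⟩
  calc (Fintype.card V : ℕ∞) ≤ ((G.indepNum * G.chromaticNumber.toNat : ℕ) : ℕ∞) := by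
        exact_mod_cast card_le_indepNum_mul_of_colorable hc
    _ = G.indepNum * G.chromaticNumber := by push_cast; rw [ENat.coe_toNat hne]

end Literature.Combinatorics.SimpleGraph.SabidussiColoring
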